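import Mathlib
import Summits.Ventures.PercRepro2.SwOutCrossGenIter

/-!
# The product of two dropped components at one junction: definitions (blind cell PercRepro2,
night-4 g24, 2026-08-28; proofs/NIGHT4-G24.md §11)

A fibre `F₁ : FibreIter` (a component, or a product already built, with its injection `theta`)
and a second component `F₂ : FibreDataBit` (with `psi` on its non-core points and `theta` on all
its non-red-leaking points).  The PRODUCT cube: points `(s, w₁, w₂)`, atoms `AtomG (A₁ ⊕ A₂) ι`,
the leak of either component, the red atoms of both (when some u-arm is red), the type
`(s, label₁, label₂)` with the product order.  `FibreIter.prod` is the product as a `FibreIter`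
(with `theta = theta₁ × theta₂`), so that products iterate; the inequality of the product from
that of `F₁` is `SwOutCrossGenProdThm`.
-/

namespace Summit.Ventures.PercRepro2

namespace CrossArm

section Defs

variable {W₁ A₁ L₁ W₂ A₂ L₂ : Type*} {ι : Type*}

/-- A point of the product cube. -/
abbrev PtP (W₁ W₂ ι : Type*) := Config ι × W₁ × W₂

/-- The atoms of the product cube. -/
abbrev AtomPr (A₁ A₂ ι : Type*) := AtomG (A₁ ⊕ A₂) ι

/-- The types of the product cube. -/
abbrev TypP (L₁ L₂ ι : Type*) := Config ι × L₁ × L₂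

/-- The atoms of the first cube as atoms of the product. -/
def liftA₁ : AtomG A₁ ι → AtomPr A₁ A₂ ι
  | Sum.inl j => Sum.inl j
  | Sum.inr (Sum.inl u) => Sum.inr (Sum.inl u)
  | Sum.inr (Sum.inr a) => Sum.inr (Sum.inr (Sum.inl a))

/-- An atom of the second component as an atom of the product. -/
def atomA₂ (a : A₂) : AtomPr A₁ A₂ ι := Sum.inr (Sum.inr (Sum.inr a))

/-- `liftA₁` is injective. -/
lemma liftA₁_injective : Function.Injective (liftA₁ : AtomG A₁ ι → AtomPr A₁ A₂ ι) := by
  rintro (j | (u | a)) (j' | (u' | a')) h <;> simp [liftA₁] at h <;> simp [h]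

/-- A lifted atom is in the lifted image iff the atom is in the set. -/
lemma liftA₁_mem_image_iff (S : Set (AtomG A₁ ι)) (b : AtomG A₁ ι) :
    (liftA₁ b : AtomPr A₁ A₂ ι) ∈ liftA₁ '' S ↔ b ∈ S :=
  Function.Injective.mem_set_image liftA₁_injective

/-- An atom of the second component is not a lifted atom. -/
lemma atomA₂_notMem_lift (S : Set (AtomG A₁ ι)) (a : A₂) :
    (atomA₂ a : AtomPr A₁ A₂ ι) ∉ liftA₁ '' S := by
  rintro ⟨(j | (u | b)), -, h⟩ <;> simp [liftA₁, atomA₂] at h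

variable (F₁ : FibreIter W₁ A₁ L₁) (F₂ : FibreDataBit W₂ A₂ L₂)

/-- The leak of a product point. -/
def LeakP (x : PtP W₁ W₂ ι) : Prop :=
  LeakI F₁ (x.1, x.2.1) ∨ (redUG x.1 ∧ F₂.leakR x.2.2 = true) ∨
    (blueUG x.1 ∧ F₂.leakR (F₂.flip x.2.2) = true)

/-- The red atoms of a product point. -/
def ERP (x : PtP W₁ W₂ ι) : Set (AtomPr A₁ A₂ ι) :=
  liftA₁ '' ERI F₁ (x.1, x.2.1) ∪ {b | ∃ a, b = atomA₂ a ∧ redUG x.1 ∧ F₂.red x.2.2 a = true}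

/-- The total flip. -/
def flipP (x : PtP W₁ W₂ ι) : PtP W₁ W₂ ι := (flipAll x.1, F₁.flip x.2.1, F₂.flip x.2.2)

/-- The blue atoms: the red atoms of the flip. -/
def EBP (x : PtP W₁ W₂ ι) : Set (AtomPr A₁ A₂ ι) := ERP F₁ F₂ (flipP F₁ F₂ x)

/-- The type of a product point. -/
def typP (x : PtP W₁ W₂ ι) : TypP L₁ L₂ ι := (x.1, F₁.label x.2.1, F₂.label x.2.2)

/-- `t'` is at least as good a type as `t`. -/
def BetterP (t' t : TypP L₁ L₂ ι) : Prop :=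
  (∀ j, t.1 j = false → t'.1 j = false) ∧ F₁.BetterL t'.2.1 t.2.1 ∧ F₂.BetterL t'.2.2 t.2.2

/-- An up-set of product types. -/
def IsUpP (𝒯 : Set (TypP L₁ L₂ ι)) : Prop := ∀ t ∈ 𝒯, ∀ t', BetterP F₁ F₂ t' t → t' ∈ 𝒯

/-- The frozen blue set at a fibre point `c` of the second component: the first cube's blue atoms
and the red atoms of `c` when some u-arm is blue. -/
def EBpreP (c : W₂) (x : PtP W₁ W₂ ι) : Set (AtomPr A₁ A₂ ι) :=
  liftA₁ '' EBI F₁ (x.1, x.2.1) ∪ {b | ∃ a, b = atomA₂ a ∧ blueUG x.1 ∧ F₂.red c a = true}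

/-- The sliced up-set of types at a label of the second component. -/
def sliceTP (𝒯 : Set (TypP L₁ L₂ ι)) (l : L₂) : Set (TypG L₁ ι) := {t | (t.1, t.2, l) ∈ 𝒯}

/-- The sliced up-set of atom sets at a fibre point `c` of the second component. -/
def sliceEP (𝓔 : Set (Set (AtomPr A₁ A₂ ι))) (c : W₂) : Set (Set (AtomG A₁ ι)) :=
  {S | liftA₁ '' S ∪ {b | ∃ a, b = atomA₂ a ∧ uAtomG ∈ S ∧ F₂.red c a = true} ∈ 𝓔}

variable [Fintype ι] [DecidableEq ι] [Fintype W₁] [DecidableEq W₁] [Fintype W₂] [DecidableEq W₂]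

open scoped Classical in
/-- The non-leaking product points whose type lies in `𝒯`. -/
noncomputable def QP (𝒯 : Set (TypP L₁ L₂ ι)) : Finset (PtP W₁ W₂ ι) :=
  Finset.univ.filter fun x => ¬ LeakP F₁ F₂ x ∧ typP F₁ F₂ x ∈ 𝒯

end Defs

section Prod

variable {W₁ A₁ L₁ W₂ A₂ L₂ : Type*} (F₁ : FibreIter W₁ A₁ L₁) (F₂ : FibreDataBit W₂ A₂ L₂)

/-- **The product of a fibre and a component as a fibre.** -/
def FibreIter.prod : FibreIter (W₁ × W₂) (A₁ ⊕ A₂) (L₁ × L₂) where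
  flip := fun x => (F₁.flip x.1, F₂.flip x.2)
  flip_flip := fun x => by simp [F₁.flip_flip, F₂.flip_flip]
  red := fun x a => match a with
    | Sum.inl a => F₁.red x.1 a
    | Sum.inr a => F₂.red x.2 a
  leakR := fun x => F₁.leakR x.1 || F₂.leakR x.2
  label := fun x => (F₁.label x.1, F₂.label x.2)
  BetterL := fun l' l => F₁.BetterL l'.1 l.1 ∧ F₂.BetterL l'.2 l.2
  betterL_refl := fun l => ⟨F₁.betterL_refl _, F₂.betterL_refl _⟩
  theta := fun x => (F₁.theta x.1, F₂.theta x.2)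
  theta_ok := fun x hx => by
    obtain ⟨w₁, w₂⟩ := x
    simp only [Bool.or_eq_false_iff] at hx
    obtain ⟨h1, h2, h3⟩ := F₁.theta_ok w₁ hx.1
    obtain ⟨h1', h2', h3'⟩ := F₂.theta_ok w₂ hx.2
    refine ⟨by simp [h1, h1'], ⟨h2, h2'⟩, fun a ha => ?_⟩
    cases a with
    | inl a => exact h3 a ha
    | inr a => exact h3' a ha
  theta_inj := fun x x' hx hx' h => by
    obtain ⟨w₁, w₂⟩ := x
    obtain ⟨w₁', w₂'⟩ := x'
    simp only [Bool.or_eq_false_iff] at hx hx'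
    simp only [Prod.mk.injEq] at h
    exact Prod.ext (F₁.theta_inj _ _ hx.1 hx'.1 h.1) (F₂.theta_inj _ _ hx.2 hx'.2 h.2)

end Prod

end CrossArm

end Summit.Ventures.PercRepro2
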